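import Mathlib
import Summits.AtomisticToContinuum.FouriersLaw.Theses.EmbeddedDrudeMourre
import Literature.MathematicalPhysics.KineticTheory.ZeroWavenumberSpace
import Literature.MathematicalPhysics.KineticTheory.ChainReflection
import HarnessLib

/-!
# `EmbeddedDrudeMourre.MourreDissolution`, line `separable-vertex-faddeev-pair-sector` —
# Stub 4: the reflection-odd reduction of the Koopman group

Item `stmt-AtomisticToContinuum-12594` (crux `MourreDissolution` of route `EmbeddedDrudeMourre`,
sub-problem `FouriersLaw`), registered stub `stub_reflectionOddReduction` of the line skeleton
`Cruxes/MourreDissolution/Lines/separable_vertex_faddeev_pair_sector.lean`.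

Let `Z` be zero-wavenumber data (Doyon's `ℋ₀ = ZeroWavenumberSpace Z`) of the pinned anharmonic
chain `pinnedChain ω₂ lam β γ` with dynamics `D`, and let `ι σ x = σ (-x)` be the spatial reflection
of chain configurations. Assume that the local observables are `ι`-stable, that the flow is
`ι`-covariant `Z.μ`-a.e. (`ι ∘ φ_t = φ_t ∘ ι`), and that the Koopman group `U_t = Z.koopman t` is
strongly continuous. Then the REFLECTION-ODD SECTOR

  `𝒦 = closure (span {[a] - [a ∘ ι] : a ∈ 𝒱})`

(i) contains the current class `[J] = Z.currentClass`, and (ii) is invariant under every `U_t`, the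
restrictions `V t = U_t|_𝒦` forming a strongly continuous one-parameter group of linear isometries
of `𝒦` which agrees with `U_t` under the inclusion `𝒦 ⊆ ℋ₀`.

Proof.
* (i) `currentClass_mem_oddSpanClosure`: the FPU-`β` coupling `V(r) = r²/2 + βr⁴/4` is even
  (`pinnedChain_V_neg`), so `V'` is odd (`OscillatorChain.deriv_V_neg`) and the bond current
  `j_x = -½(p_x + p_{x+1}) V'(q_{x+1} - q_x)` satisfies `j₀ ∘ ι = -j₋₁` POINTWISE
  (`bondCurrentZ_zero_comp_reflection`); since `[j₋₁] = [j₀] = [J]` (`fluct_bondCurrentZ`),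
  `[j₀] - [j₀ ∘ ι] = 2 [J]`, so `[J]` lies in the span, hence in its closure.
* (ii) `koopman_mem_oddGenerators`: for `a ∈ 𝒱`, `U_t ([a] - [a ∘ ι]) = [a ∘ φ_t] - [a ∘ ι ∘ φ_t]`
  (`koopman_fluct`) and `a ∘ ι ∘ φ_t = a ∘ φ_t ∘ ι` a.e., both sides in `𝒱`, so by `fluct_congr_ae`
  this is `[b] - [b ∘ ι]` with `b = a ∘ φ_t ∈ 𝒱`: the generating set is mapped into itself, hence
  so is its span (`Submodule.span_le`) and, `U_t` being continuous, the closure of the span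
  (`map_mem_closure`) — `koopman_mem_oddSpanClosure`.
* (iii) `exists_restrictedGroup`: for ANY `U_t`-invariant submodule `𝒦`, the corestriction
  `V t := codRestrict (U_t ∘ subtype) 𝒦` is a strongly continuous isometry group on `𝒦` agreeing
  with `U_t` (group law `koopman_add_apply`, `U_0 = 1`, `‖U_t ψ‖ = ‖ψ‖`, continuity through the
  induced topology).
No measure preservation by `ι` is used. Sources: folklore; Doyon 2022 §4.3 (the Koopman group on
`ℋ₀`).
-/

noncomputable section

namespace Summit.AtomisticToContinuum.FouriersLaw.Theorems.MourreDissolution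

open Filter Topology MeasureTheory Set Function
open scoped InnerProductSpace
open Literature.MathematicalPhysics.KineticTheory
open Literature.MathematicalPhysics.KineticTheory.HeatConduction

/-! ### 1. Invariance of the odd sector under the Koopman group (any reflection `ι`) -/

section General

variable {P : OscillatorChain} {D : InfiniteChainDynamics P} (Z : ZeroWavenumberData P D)
  (ι : ChainConfig → ChainConfig)

/-- The generating set `{[a] - [a ∘ ι] : a ∈ 𝒱}` of the `ι`-odd sector is mapped into itself by
every `U_t`, provided `𝒱` is `ι`-stable and `ι` commutes with the flow a.e.:
`U_t ([a] - [a ∘ ι]) = [a ∘ φ_t] - [(a ∘ φ_t) ∘ ι]`. [folklore] -/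
theorem koopman_mem_oddGenerators (hι : ∀ a : ChainConfig → ℝ, a ∈ Z.localObs → a ∘ ι ∈ Z.localObs)
    (hflow : ∀ t : ℝ, ι ∘ D.flow t =ᵐ[Z.μ] D.flow t ∘ ι) (t : ℝ) {ψ : ZeroWavenumberSpace Z}
    (hψ : ψ ∈ {ψ : ZeroWavenumberSpace Z |
      ∃ a : ChainConfig → ℝ, a ∈ Z.localObs ∧ ψ = Z.fluct a - Z.fluct (a ∘ ι)}) :
    Z.koopman t ψ ∈ {ψ : ZeroWavenumberSpace Z |
      ∃ a : ChainConfig → ℝ, a ∈ Z.localObs ∧ ψ = Z.fluct a - Z.fluct (a ∘ ι)} := by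
  obtain ⟨a, ha, rfl⟩ := hψ
  refine ⟨a ∘ D.flow t, Z.comp_flow_mem t ha, ?_⟩
  rw [map_sub, Z.koopman_fluct t ha, Z.koopman_fluct t (hι a ha)]
  congr 1
  exact FluctuationStructure.fluct_congr_ae (Z.comp_flow_mem t (hι a ha))
    (hι _ (Z.comp_flow_mem t ha)) ((hflow t).fun_comp a)

/-- The span of the generating set is `U_t`-invariant. [folklore] -/
theorem koopman_mem_oddSpan (hι : ∀ a : ChainConfig → ℝ, a ∈ Z.localObs → a ∘ ι ∈ Z.localObs)
    (hflow : ∀ t : ℝ, ι ∘ D.flow t =ᵐ[Z.μ] D.flow t ∘ ι) (t : ℝ) {ψ : ZeroWavenumberSpace Z}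
    (hψ : ψ ∈ Submodule.span ℝ {ψ : ZeroWavenumberSpace Z |
      ∃ a : ChainConfig → ℝ, a ∈ Z.localObs ∧ ψ = Z.fluct a - Z.fluct (a ∘ ι)}) :
    Z.koopman t ψ ∈ Submodule.span ℝ {ψ : ZeroWavenumberSpace Z |
      ∃ a : ChainConfig → ℝ, a ∈ Z.localObs ∧ ψ = Z.fluct a - Z.fluct (a ∘ ι)} := by
  have hle : Submodule.span ℝ {ψ : ZeroWavenumberSpace Z |
        ∃ a : ChainConfig → ℝ, a ∈ Z.localObs ∧ ψ = Z.fluct a - Z.fluct (a ∘ ι)} ≤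
      (Submodule.span ℝ {ψ : ZeroWavenumberSpace Z |
        ∃ a : ChainConfig → ℝ, a ∈ Z.localObs ∧ ψ = Z.fluct a - Z.fluct (a ∘ ι)}).comap
        ((Z.koopman t).toLinearEquiv : ZeroWavenumberSpace Z →ₗ[ℝ] ZeroWavenumberSpace Z) :=
    Submodule.span_le.2 fun φ hφ =>
      Submodule.subset_span (koopman_mem_oddGenerators Z ι hι hflow t hφ)
  exact hle hψ

/-- **The `ι`-odd sector `closure (span {[a] - [a ∘ ι]})` is `U_t`-invariant** (continuity of
`U_t` carries the invariance of the span to its closure). [folklore] -/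
theorem koopman_mem_oddSpanClosure
    (hι : ∀ a : ChainConfig → ℝ, a ∈ Z.localObs → a ∘ ι ∈ Z.localObs)
    (hflow : ∀ t : ℝ, ι ∘ D.flow t =ᵐ[Z.μ] D.flow t ∘ ι) (t : ℝ) {ψ : ZeroWavenumberSpace Z}
    (hψ : ψ ∈ (Submodule.span ℝ {ψ : ZeroWavenumberSpace Z |
      ∃ a : ChainConfig → ℝ, a ∈ Z.localObs ∧ ψ = Z.fluct a - Z.fluct (a ∘ ι)}).topologicalClosure) :
    Z.koopman t ψ ∈ (Submodule.span ℝ {ψ : ZeroWavenumberSpace Z |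
      ∃ a : ChainConfig → ℝ, a ∈ Z.localObs ∧ ψ = Z.fluct a - Z.fluct (a ∘ ι)}).topologicalClosure := by
  rw [← SetLike.mem_coe, Submodule.topologicalClosure_coe] at hψ ⊢
  exact map_mem_closure (Z.koopman t).continuous hψ
    fun φ hφ => koopman_mem_oddSpan Z ι hι hflow t hφ

/-! ### 2. The restricted group on an invariant subspace -/

omit ι in
/-- **Restriction of the Koopman group to an invariant subspace.** If `𝒦 ≤ ℋ₀` is invariant under
every `U_t` and `U` is strongly continuous, the corestrictions `V t = U_t|_𝒦 : 𝒦 →L[ℝ] 𝒦` form a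
strongly continuous one-parameter group of linear isometries of `𝒦` agreeing with `U_t` under the
inclusion. [folklore] -/
theorem exists_restrictedGroup
    (hcont : ∀ ψ : ZeroWavenumberSpace Z, Continuous fun t : ℝ => Z.koopman t ψ)
    (𝒦 : Submodule ℝ (ZeroWavenumberSpace Z))
    (hinv : ∀ (t : ℝ) (ψ : ZeroWavenumberSpace Z), ψ ∈ 𝒦 → Z.koopman t ψ ∈ 𝒦) :
    ∃ V : ℝ → ↥𝒦 →L[ℝ] ↥𝒦, V 0 = ContinuousLinearMap.id ℝ ↥𝒦 ∧
      (∀ s t : ℝ, V (s + t) = (V s).comp (V t)) ∧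
      (∀ (t : ℝ) (ψ : ↥𝒦), ‖V t ψ‖ = ‖ψ‖) ∧
      (∀ ψ : ↥𝒦, Continuous fun t : ℝ => V t ψ) ∧
      (∀ (t : ℝ) (ψ : ↥𝒦),
        ((V t ψ : ↥𝒦) : ZeroWavenumberSpace Z) = Z.koopman t (ψ : ZeroWavenumberSpace Z)) := by
  let V : ℝ → ↥𝒦 →L[ℝ] ↥𝒦 := fun t =>
    (((Z.koopman t).toContinuousLinearEquiv :
        ZeroWavenumberSpace Z →L[ℝ] ZeroWavenumberSpace Z).comp 𝒦.subtypeL).codRestrict 𝒦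
      fun ψ => hinv t ψ ψ.2
  have hV : ∀ (t : ℝ) (ψ : ↥𝒦),
      ((V t ψ : ↥𝒦) : ZeroWavenumberSpace Z) = Z.koopman t (ψ : ZeroWavenumberSpace Z) :=
    fun t ψ => rfl
  refine ⟨V, ?_, ?_, ?_, ?_, hV⟩
  · ext ψ
    rw [hV, ContinuousLinearMap.id_apply]
    exact FluctuationDynamics.koopman_zero_apply _ _
  · intro s t
    ext ψ
    rw [hV, ContinuousLinearMap.comp_apply, hV, hV]
    exact FluctuationDynamics.koopman_add_apply _ s t _
  · intro t ψ
    rw [Submodule.coe_norm, hV, LinearIsometryEquiv.norm_map, Submodule.coe_norm]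
  · intro ψ
    exact (hcont (ψ : ZeroWavenumberSpace Z)).subtype_mk fun t => hinv t _ ψ.2

end General

/-! ### 3. The current class is reflection-odd for the pinned chain -/

section Pinned

variable {ω₂ lam β γ : ℝ} {D : InfiniteChainDynamics (pinnedChain ω₂ lam β γ)}
  (Z : ZeroWavenumberData (pinnedChain ω₂ lam β γ) D)

omit Z in
/-- **`j₀ ∘ ι = -j₋₁`** for the pinned chain: the bond current
`j_x = -½(p_x + p_{x+1}) V'(q_{x+1} - q_x)` of an even coupling `V` is odd under the spatial
reflection `ι σ x = σ (-x)`, the reflected bond `(0, 1)` being the bond `(-1, 0)`. [folklore] -/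
theorem bondCurrentZ_zero_comp_reflection :
    ((fun σ : ChainConfig => (pinnedChain ω₂ lam β γ).bondCurrentZ σ 0) ∘
        fun (σ : ℤ → ℝ × ℝ) (x : ℤ) => σ (-x)) =
      -fun σ : ChainConfig => (pinnedChain ω₂ lam β γ).bondCurrentZ σ (-1) := by
  funext σ
  simp only [comp_apply, Pi.neg_apply, OscillatorChain.bondCurrentZ, neg_zero, zero_add,
    neg_add_cancel]
  rw [show (σ (-1)).1 - (σ 0).1 = -((σ 0).1 - (σ (-1)).1) by ring,
    (pinnedChain ω₂ lam β γ).deriv_V_neg (pinnedChain_V_neg ω₂ lam β γ)]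
  ring

/-- `j₋₁ = j₀ ∘ τ₋₁` is a local observable. [folklore] -/
theorem bondCurrentZ_neg_one_mem :
    (fun σ : ChainConfig => (pinnedChain ω₂ lam β γ).bondCurrentZ σ (-1)) ∈ Z.localObs := by
  rw [← (pinnedChain ω₂ lam β γ).bondCurrentZ_comp_chainShift (-1)]
  exact Z.comp_shift_mem (-1) Z.bondCurrent_mem

/-- `[j₀] - [j₀ ∘ ι] = 2 • [J]` in `ℋ₀` (`[j₋₁] = [J]` because translations act trivially). [folklore] -/
theorem fluct_sub_fluct_comp_reflection_eq :
    Z.fluct (fun σ : ChainConfig => (pinnedChain ω₂ lam β γ).bondCurrentZ σ 0) -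
        Z.fluct ((fun σ : ChainConfig => (pinnedChain ω₂ lam β γ).bondCurrentZ σ 0) ∘
          fun (σ : ℤ → ℝ × ℝ) (x : ℤ) => σ (-x)) =
      (2 : ℝ) • Z.currentClass := by
  rw [bondCurrentZ_zero_comp_reflection, FluctuationStructure.fluct_neg (bondCurrentZ_neg_one_mem Z),
    Z.fluct_bondCurrentZ (-1), ← Z.currentClass_def, sub_neg_eq_add, two_smul]

/-- **`[J]` lies in the reflection-odd sector** `closure (span {[a] - [a ∘ ι] : a ∈ 𝒱})` of the
pinned chain: `[J] = ½([j₀] - [j₀ ∘ ι])` with `j₀ ∈ 𝒱`. [folklore] -/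
theorem currentClass_mem_oddSpanClosure :
    Z.currentClass ∈ (Submodule.span ℝ {ψ : ZeroWavenumberSpace Z |
      ∃ a : (ℤ → ℝ × ℝ) → ℝ, a ∈ Z.localObs ∧
        ψ = Z.fluct a - Z.fluct (a ∘ fun (σ : ℤ → ℝ × ℝ) (x : ℤ) => σ (-x))}).topologicalClosure := by
  apply Submodule.le_topologicalClosure
  have hmem : Z.fluct (fun σ : ChainConfig => (pinnedChain ω₂ lam β γ).bondCurrentZ σ 0) -
      Z.fluct ((fun σ : ChainConfig => (pinnedChain ω₂ lam β γ).bondCurrentZ σ 0) ∘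
        fun (σ : ℤ → ℝ × ℝ) (x : ℤ) => σ (-x)) ∈
      Submodule.span ℝ {ψ : ZeroWavenumberSpace Z |
        ∃ a : (ℤ → ℝ × ℝ) → ℝ, a ∈ Z.localObs ∧
          ψ = Z.fluct a - Z.fluct (a ∘ fun (σ : ℤ → ℝ × ℝ) (x : ℤ) => σ (-x))} :=
    Submodule.subset_span ⟨_, Z.bondCurrent_mem, rfl⟩
  rw [fluct_sub_fluct_comp_reflection_eq] at hmem
  exact (Submodule.smul_mem_iff _ (two_ne_zero' ℝ)).1 hmem

end Pinned

/-! ### 4. The registered stub -/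

/-- **Stub 4 — REFLECTION-ODD REDUCTION** (line `separable-vertex-faddeev-pair-sector` of crux
`MourreDissolution`). For zero-wavenumber data `Z` of `pinnedChain ω₂ lam β γ` whose local
observables are stable under the spatial reflection `ι σ = σ(−·)`, whose flow is `ι`-covariant
`Z.μ`-a.e., and whose Koopman group is strongly continuous, the reflection-odd sector
`𝒦 = closure span{[a] − [a∘ι] : a local}` (i) contains the current class `[J]` (`j₀∘ι = −j₋₁` and
`[j₋₁] = [j₀]`, so `[j₀] − [j₀∘ι] = 2[J]`) and (ii) reduces the Koopman group: `V t := U_t|_𝒦` is a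
strongly continuous one-parameter group of linear isometries of `𝒦` agreeing with `U_t` under the
inclusion. [folklore] -/
theorem stub_reflectionOddReduction :
    ∀ (ω₂ lam β γ : ℝ)
      (D : Literature.MathematicalPhysics.KineticTheory.HeatConduction.InfiniteChainDynamics
        (Literature.MathematicalPhysics.KineticTheory.HeatConduction.pinnedChain ω₂ lam β γ))
      (Z : Literature.MathematicalPhysics.KineticTheory.HeatConduction.ZeroWavenumberData
        (Literature.MathematicalPhysics.KineticTheory.HeatConduction.pinnedChain ω₂ lam β γ) D),
      (∀ a : (ℤ → ℝ × ℝ) → ℝ, a ∈ Z.localObs →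
        (a ∘ fun (σ : ℤ → ℝ × ℝ) (x : ℤ) => σ (-x)) ∈ Z.localObs) →
      (∀ t : ℝ, (fun (σ : ℤ → ℝ × ℝ) (x : ℤ) => σ (-x)) ∘ D.flow t =ᵐ[Z.μ]
        D.flow t ∘ fun (σ : ℤ → ℝ × ℝ) (x : ℤ) => σ (-x)) →
      (∀ ψ : Literature.MathematicalPhysics.KineticTheory.HeatConduction.ZeroWavenumberSpace Z,
        Continuous fun t : ℝ => Z.koopman t ψ) →
      ∀ 𝒦 : Submodule ℝ
          (Literature.MathematicalPhysics.KineticTheory.HeatConduction.ZeroWavenumberSpace Z),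
        𝒦 = (Submodule.span ℝ
              {ψ : Literature.MathematicalPhysics.KineticTheory.HeatConduction.ZeroWavenumberSpace Z |
                ∃ a : (ℤ → ℝ × ℝ) → ℝ, a ∈ Z.localObs ∧
                  ψ = Z.fluct a - Z.fluct (a ∘ fun (σ : ℤ → ℝ × ℝ) (x : ℤ) => σ (-x))}).topologicalClosure →
        Z.currentClass ∈ 𝒦 ∧
        ∃ V : ℝ → ↥𝒦 →L[ℝ] ↥𝒦, V 0 = ContinuousLinearMap.id ℝ ↥𝒦 ∧
          (∀ s t : ℝ, V (s + t) = (V s).comp (V t)) ∧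
          (∀ (t : ℝ) (ψ : ↥𝒦), ‖V t ψ‖ = ‖ψ‖) ∧
          (∀ ψ : ↥𝒦, Continuous fun t : ℝ => V t ψ) ∧
          (∀ (t : ℝ) (ψ : ↥𝒦),
            ((V t ψ : ↥𝒦) :
                Literature.MathematicalPhysics.KineticTheory.HeatConduction.ZeroWavenumberSpace Z) =
              Z.koopman t
                (ψ : Literature.MathematicalPhysics.KineticTheory.HeatConduction.ZeroWavenumberSpace Z)) := by
  intro ω₂ lam β γ D Z hι hflow hcont 𝒦 h𝒦
  subst h𝒦
  exact ⟨currentClass_mem_oddSpanClosure Z,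
    exists_restrictedGroup Z hcont _ fun t ψ hψ =>
      koopman_mem_oddSpanClosure Z (fun (σ : ℤ → ℝ × ℝ) (x : ℤ) => σ (-x)) hι hflow t hψ⟩

end Summit.AtomisticToContinuum.FouriersLaw.Theorems.MourreDissolution

end
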